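import Summits.QuantumFields.BalabanUV.T4Continuum.Support.NE7LatticeLandauReg910
import Summits.QuantumFields.BalabanUV.T4Continuum.Support.NE7Reg10ImpliesReg9
import Summits.QuantumFields.BalabanUV.T4Continuum.Support.NE7AllMinimisersRegularSpaceGeneric
import HarnessLib

/-!
# NE7AllMinimisersLandauReg910 — FOR EVERY CONSTRAINED SMALL-FIELD MINIMISER (row NE7's objects: `IsMinimiser 4 (sfClass 4 L N ε) L N k V U`, every `U(n)`, every
# `L ≥ 2`): the exact lattice Landau gauge on its torus EXISTS, and IF its representative has the printed sup currency `‖A₀‖ ≤ c₀ε∕M` (`M = L^k`; the ONE displayed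
# letter) THEN [Balaban1985Variational] Thm 1's (9)₂ `‖∇A₀‖ ≤ 4(4c₀ + C_J + 1)ε∕M²`, (10) `‖ΔA₀‖ ≤ (C_J + 2)ε∕M³` and (9)₃ FOR EVERY `β < 1`,
# `‖∇A₀(z) − ∇A₀(z′)‖ ≤ 3C(1 + (1−β)⁻¹)(C_J + 2 + c₀)·ε·h^β∕M^{2+β}` over the full physical range `h ≤ 2M − 2`, hold with constants INDEPENDENT OF `k`
# (file F7 = the docking of gen 112's line «flat interior C^{1,log-Lip} potential theory + (10) ⟹ (9)_{β<1}»)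

Cell `pub-balaban`, rung (B)+1 sub-cell t4, lineage `b2b-balaban-t4-ne7-p1` (CRUX PROVER NE7 #1 = OWNER of BINDER row NE7), generation 112.  Memo
`t4/b2b-balaban-t4-ne7-p1-g112/ROAD-G112.md` §4.  BY NAME over F6 `NE7LatticeLandauReg910.landau_reg910` (the torus package), F4 `NE7Reg10ImpliesReg9.rpow_scaling`, and gen 111's
✓ p814818 `NE7AllMinimisersRegularSpaceGeneric.all_minimisers_regularSpace_generic` ((1.7)-type `SmallField U (ε∕M²)` and the LOG-FREE (1.9)-type current
`‖covDiv 1 U ν y‖ ≤ C_J ε∕M³` of every minimiser, `C_J = C_J(L, card n)`).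
WHAT IS PROVED (**`all_minimisers_landau_reg910`**, 0 def, 0 sorry).  `∃ C ≥ 0` (F3's potential-theory constant at `d = 4`), `∃ C_J ≥ 0`, `∃ ε₀ > 0`, `∀ 0 < ε ≤ ε₀`, `∀ N ≥ 1`,
`∃ δ_V > 0`, for every datum `V` (unitary, `N`-periodic, `SmallField V δ_V`), every level `k` and every minimiser `U`: THERE IS a unitary `(N·L^k)`-periodic gauge `u`
(`u 0 = 1`, the trace-link minimiser of (161a)) whose representative `U^{u}` satisfies the lattice Landau condition at every site ((161b)), and for every skew-Hermitian
`(N·L^k)`-periodic `A₀` with `U^{u} = e^{A₀}` and every `c₀ ≥ 0` WITH `‖A₀‖ ≤ c₀ε∕L^k` (DISPLAYED) in the regime `600(c₀ + 1)(4c₀ + C_J + 1)ε ≤ 1` (k-free): the three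
displayed inequalities above (`M = L^k`, cubes `cube x (M − 1)` of pv23's `Beta/PoissonInterior`, `h = supNorm (z − z′)`).
WHAT IS NOT.  The sup letter `‖A₀‖ ≤ c₀ε∕M` of the torus Landau representative is NOT proved — it is the crux (ROAD-G112 §4: on a torus it is obstructed in general by the
datum's non-abelian holonomies, the zero modes of the gauge potential; print's Thm 1 works on cubes `□` of size `M(ε₁)` with a local gauge, where the tree has the a priori
sup letter and the one-scale Uhlenbeck existence — gen 93 `NE7LatticeUhlenbeckBox` — but not the boundary regularity).  NOT (9) at `β = 1` (junction logarithm, ROAD-G110 §4).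
Nothing of Bałaban's asserted; OUR minimisers (B11 (8) with `sfClass`), OUR route; NOT NE3∕NE7 as spine nodes; spine 0∕9; finite T⁴ rung (B)+1 — NOT infinite volume, NOT mass
gap, NOT BetaPertH, NOT Clay (continuum YM on T⁴ ⇐ BetaPertH ∧ nine spine estimates).
-/

set_option autoImplicit false

open NormedSpace
open scoped BigOperators Matrix Matrix.Norms.L2Operator
open Finset

namespace Summit.QuantumFields.BalabanUV.T4Continuum.NE7AllMinimisersLandauReg910

open Literature.MathematicalPhysics.QuantumFieldTheory.Balaban1983to89
open B7Prop1Explicit B7Prop2Explicit MatrixNorms UnitaryModel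
open B8Ineq132 (covDiv)
open T4AveragingDeficitWall (vary SmallField IsUnitaryCfg)
open T4AveragingDeficitWallBoundary (IsPeriodicCfg periodBox mem_periodBox)
open AveragingDeficitPeriodicCounting (IsPeriodicDir)
open BlockAveragePushDirSplit (flat)
open Beta.PoissonInterior (cube supNorm)
open MinimalActionSandwich (IsMinimiser admissible)
open MinimalActionRate (sfClass)
open NE7LatticeLandauReg910 (landau_reg910)
open NE7Reg10ImpliesReg9 (rpow_scaling)
open NE7AllMinimisersRegularSpaceGeneric (all_minimisers_regularSpace_generic)

noncomputable section

variable {n : Type} [Fintype n] [DecidableEq n] [Nonempty n]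

/-! ## §1 Real arithmetic of the regime -/

omit [Fintype n] [DecidableEq n] [Nonempty n] in
/-- The regime `600(c₀+1)(4c₀+C_J+1)ε ≤ 1` delivers the three smallness lines used below: `576c₀ε ≤ 1`, `(16c₀ + 24)ε ≤ 1`, `576c₀(4c₀+C_J+1)ε ≤ 1`, and `ε ≤ 1`. [folklore] -/
theorem regime_lines {c₀ CJ ε : ℝ} (hc₀ : 0 ≤ c₀) (hCJ : 0 ≤ CJ) (hε : 0 ≤ ε) (hreg : 600 * (c₀ + 1) * (4 * c₀ + CJ + 1) * ε ≤ 1) :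
    576 * c₀ * ε ≤ 1 ∧ (16 * c₀ + 24) * ε ≤ 1 ∧ 576 * c₀ * (4 * c₀ + CJ + 1) * ε ≤ 1 ∧ ε ≤ 1 := by
  have h1 : (1 : ℝ) ≤ 4 * c₀ + CJ + 1 := by linarith
  have hA : 576 * c₀ * ε ≤ 600 * (c₀ + 1) * (4 * c₀ + CJ + 1) * ε := by
    have : 576 * c₀ ≤ 600 * (c₀ + 1) * (4 * c₀ + CJ + 1) := by nlinarith
    exact mul_le_mul_of_nonneg_right this hε
  have hB : (16 * c₀ + 24) * ε ≤ 600 * (c₀ + 1) * (4 * c₀ + CJ + 1) * ε := by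
    have : 16 * c₀ + 24 ≤ 600 * (c₀ + 1) * (4 * c₀ + CJ + 1) := by nlinarith
    exact mul_le_mul_of_nonneg_right this hε
  have hC : 576 * c₀ * (4 * c₀ + CJ + 1) * ε ≤ 600 * (c₀ + 1) * (4 * c₀ + CJ + 1) * ε := by
    have : 576 * c₀ * (4 * c₀ + CJ + 1) ≤ 600 * (c₀ + 1) * (4 * c₀ + CJ + 1) := by nlinarith
    exact mul_le_mul_of_nonneg_right this hε
  have hD : ε ≤ 600 * (c₀ + 1) * (4 * c₀ + CJ + 1) * ε := by
    have : (1 : ℝ) ≤ 600 * (c₀ + 1) * (4 * c₀ + CJ + 1) := by nlinarith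
    nlinarith
  exact ⟨hA.trans hreg, hB.trans hreg, hC.trans hreg, hD.trans hreg⟩

/-! ## §2 The docking -/

/-- **[Balaban1985Variational] Thm 1 (9)₂, (10), (9)₃^{β<1} FOR EVERY CONSTRAINED MINIMISER, `k`-UNIFORMLY, MODULO THE SUP LETTER OF ITS TORUS LANDAU REPRESENTATIVE** — see the
module docstring.  The Landau gauge `u` is PRODUCED (trace-link minimiser, Landau condition at every site); the representative's logarithm `A₀` and its sup currency
`‖A₀‖ ≤ c₀ε∕L^k` are the displayed hypotheses. [folklore] -/
theorem all_minimisers_landau_reg910 {L : ℕ} (hL : 2 ≤ L) :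
    ∃ C : ℝ, 0 ≤ C ∧ ∃ CJ : ℝ, 0 ≤ CJ ∧ ∃ ε₀ : ℝ, 0 < ε₀ ∧ ∀ ε : ℝ, 0 < ε → ε ≤ ε₀ → ∀ (N : ℕ) [NeZero N], 1 ≤ N →
      ∃ δV : ℝ, 0 < δV ∧
        ∀ V ∈ {V : Site 4 → Fin 4 → (Matrix n n ℂ)ˣ | IsUnitaryCfg V ∧ IsPeriodicCfg V (N : ℤ) ∧ SmallField V δV},
        ∀ (k : ℕ) (U : Site 4 → Fin 4 → (Matrix n n ℂ)ˣ), IsMinimiser 4 (sfClass 4 L N ε) L N k V U →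
        ∃ u : Site 4 → (Matrix n n ℂ)ˣ, (∀ x, u x ∈ unitaryUnits (Matrix n n ℂ)) ∧
          (∀ (x : Site 4) (τ : Fin 4), u (x + ((N * L ^ k : ℕ) : ℤ) • e τ) = u x) ∧ u 0 = 1 ∧
          (∀ z : Site 4, ∑ κ : Fin 4, ((((gaugeAct u U z κ : (Matrix n n ℂ)ˣ) : Matrix n n ℂ) - ((gaugeAct u U z κ : (Matrix n n ℂ)ˣ) : Matrix n n ℂ)ᴴ)
            - (((gaugeAct u U (z - e κ) κ : (Matrix n n ℂ)ˣ) : Matrix n n ℂ) - ((gaugeAct u U (z - e κ) κ : (Matrix n n ℂ)ˣ) : Matrix n n ℂ)ᴴ)) = 0) ∧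
          ∀ (A₀ : Site 4 → Fin 4 → Matrix n n ℂ), gaugeAct u U = vary (flat (d := 4) (n := n)) A₀ 1 →
            (∀ (y : Site 4) (κ : Fin 4), (A₀ y κ)ᴴ = -A₀ y κ) → IsPeriodicDir A₀ ((N * L ^ k : ℕ) : ℤ) →
            ∀ (c₀ : ℝ), 0 ≤ c₀ → (∀ (y : Site 4) (κ : Fin 4), ‖A₀ y κ‖ ≤ c₀ * ε / (L : ℝ) ^ k) →
            600 * (c₀ + 1) * (4 * c₀ + CJ + 1) * ε ≤ 1 →
            (∀ (y : Site 4) (κ τ : Fin 4), ‖A₀ (y + e τ) κ - A₀ y κ‖ ≤ 4 * (4 * c₀ + CJ + 1) * ε / ((L : ℝ) ^ k) ^ 2) ∧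
            (∀ (y : Site 4) (ν : Fin 4), ‖∑ i, ((A₀ (y + e i) ν - A₀ y ν) - (A₀ y ν - A₀ (y - e i) ν))‖ ≤ (CJ + 2) * ε / ((L : ℝ) ^ k) ^ 3) ∧
            (∀ (β : ℝ), 0 ≤ β → β < 1 → ∀ (x z z' : Site 4), z ∈ cube x (L ^ k - 1) → z' ∈ cube x (L ^ k - 1) → ∀ μ κ : Fin 4,
              ‖(A₀ (z + e μ) κ - A₀ z κ) - (A₀ (z' + e μ) κ - A₀ z' κ)‖
                ≤ 3 * C * (1 + (1 - β)⁻¹) * (CJ + 2 + c₀) * ε * (supNorm (z - z') : ℝ) ^ β / ((L : ℝ) ^ k) ^ (2 + β)) := by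
  obtain ⟨C, hC, hF6⟩ := landau_reg910 (d := 4) (n := n) (by norm_num)
  obtain ⟨CJ, hCJ, ε₁, hε₁, H⟩ := all_minimisers_regularSpace_generic (n := n) hL
  refine ⟨C, hC, CJ, hCJ, ε₁, hε₁, fun ε hε hεle N _ hN => ?_⟩
  obtain ⟨δV, hδV, HV⟩ := H ε hε hεle N hN
  refine ⟨δV, hδV, fun V hV k U hmin => ?_⟩
  obtain ⟨hSF, hcov⟩ := HV V hV k U hmin
  have hL0 : (0 : ℝ) < L := by exact_mod_cast (by omega : 0 < L)
  set M : ℕ := L ^ k with hMdef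
  have hM1 : 1 ≤ M := Nat.one_le_pow _ _ (by omega)
  have hMr : ((M : ℕ) : ℝ) = (L : ℝ) ^ k := by rw [hMdef]; push_cast; ring
  have hM0 : (0 : ℝ) < (L : ℝ) ^ k := by positivity
  have hM1r : (1 : ℝ) ≤ (L : ℝ) ^ k := one_le_pow₀ (by exact_mod_cast (by omega : 1 ≤ L))
  -- the class: periodicity of the minimiser
  have hcls : U ∈ sfClass 4 L N ε k := hmin.mem.1
  simp only [sfClass, Set.mem_setOf_eq] at hcls
  obtain ⟨-, hUP, -⟩ := hcls
  have hP : 1 ≤ N * L ^ k := Nat.one_le_iff_ne_zero.mpr (Nat.mul_ne_zero (by omega) (by positivity))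
  have hε0' : 0 ≤ ε / ((L : ℝ) ^ k) ^ 2 := by positivity
  have hcov' : ∀ (ν : Fin 4) (x : Site 4), ‖covDiv 1 U ν x‖ ≤ CJ * ε / ((L : ℝ) ^ k) ^ 3 := fun ν x => hcov ν x
  obtain ⟨u, hu, huP, hu0, hmin', hLan, hA⟩ := hF6 hP hUP hε0' hSF hcov'
  refine ⟨u, hu, huP, hu0, hLan, fun A₀ hgauge hskew hA₀P c₀ hc₀ ha₀ hreg => ?_⟩
  obtain ⟨h10, h93, h92⟩ := hA A₀ hgauge hskew (c₀ * ε / (L : ℝ) ^ k) ha₀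
  obtain ⟨hr1, hr2, hr3, hε1⟩ := regime_lines hc₀ hCJ hε.le hreg
  -- abbreviations
  set a₀ : ℝ := c₀ * ε / (L : ℝ) ^ k with ha₀def
  set εp : ℝ := ε / ((L : ℝ) ^ k) ^ 2 with hεpdef
  set j : ℝ := CJ * ε / ((L : ℝ) ^ k) ^ 3 with hjdef
  have ha₀0 : 0 ≤ a₀ := by positivity
  have hc₀ε : c₀ * ε ≤ 1 / 576 := by
    rw [le_div_iff₀ (by norm_num : (0:ℝ) < 576)]; linarith
  have ha₀le : a₀ ≤ c₀ * ε := by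
    rw [ha₀def]; exact div_le_self (by positivity) hM1r
  have ha₀s : a₀ ≤ 1 / 64 := by linarith
  have hεp1 : εp ≤ 1 := by
    rw [hεpdef]; exact (div_le_self hε.le (one_le_pow₀ hM1r)).trans hε1
  have hεp0 : 0 ≤ εp := by positivity
  -- the exponential lines (`|e^x − 1| ≤ 2|x|` on `|x| ≤ 1`, Mathlib's `Real.abs_exp_sub_one_le`; cf. the tree's
  -- `Literature.NumberTheory.Sieve.SquarefreeSums.exp_sub_one_le_two_mul`): `e^{2a₀} − 1 ≤ 4a₀`, `e^{4a₀} − 1 ≤ 8a₀`, `e^{a₀} − 1 ≤ 2a₀`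
  have exp_sub_one_le_two_mul : ∀ {x : ℝ}, 0 ≤ x → x ≤ 1 → Real.exp x - 1 ≤ 2 * x := fun {x} h0 h1 => by
    have h := Real.abs_exp_sub_one_le (x := x) (by rw [abs_of_nonneg h0]; exact h1)
    rw [abs_of_nonneg h0] at h
    exact (le_abs_self _).trans h
  have hexp2 : Real.exp (2 * a₀) - 1 ≤ 4 * a₀ := by
    have := exp_sub_one_le_two_mul (x := 2 * a₀) (by positivity) (by linarith); linarith
  have hexp4 : Real.exp (4 * a₀) - 1 ≤ 8 * a₀ := by
    have := exp_sub_one_le_two_mul (x := 4 * a₀) (by positivity) (by linarith); linarith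
  have hexp1 : Real.exp a₀ - 1 ≤ 2 * a₀ := exp_sub_one_le_two_mul ha₀0 (by linarith)
  -- `j_ε ≤ (C_J + 1) ε / M³`
  have hjε : j + 4 * (εp * ((Real.exp (2 * a₀) - 1) + 2 * εp * (2 + εp))) ≤ (CJ + 1) * ε / ((L : ℝ) ^ k) ^ 3 := by
    -- `εp((e^{2a₀}−1) + 2εp(2+εp)) ≤ εp(4a₀ + 6εp)` and `4εp(4a₀ + 6εp) ≤ (16c₀ + 24)ε · ε/M³ ≤ ε/M³`
    have h1 : (Real.exp (2 * a₀) - 1) + 2 * εp * (2 + εp) ≤ 4 * a₀ + 6 * εp := by nlinarith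
    have h2 : εp * ((Real.exp (2 * a₀) - 1) + 2 * εp * (2 + εp)) ≤ εp * (4 * a₀ + 6 * εp) := mul_le_mul_of_nonneg_left h1 hεp0
    have h3 : 4 * (εp * (4 * a₀ + 6 * εp)) ≤ ε / ((L : ℝ) ^ k) ^ 3 := by
      -- `a₀ ≤ c₀ε/M ` and `εp = ε/M²`, `εp ≤ ε/M` ... all reduced to `(16c₀+24)ε ≤ 1`
      have hM3 : (0 : ℝ) < ((L : ℝ) ^ k) ^ 3 := by positivity
      have e1 : 4 * (εp * (4 * a₀ + 6 * εp)) = (16 * c₀ * ε * ε) / ((L : ℝ) ^ k) ^ 3 + 24 * ε * ε / ((L : ℝ) ^ k) ^ 4 := by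
        rw [hεpdef, ha₀def]; field_simp; ring
      have e2 : 24 * ε * ε / ((L : ℝ) ^ k) ^ 4 ≤ 24 * ε * ε / ((L : ℝ) ^ k) ^ 3 :=
        div_le_div_of_nonneg_left (by positivity) hM3 (pow_le_pow_right₀ hM1r (by norm_num))
      rw [e1]
      calc (16 * c₀ * ε * ε) / ((L : ℝ) ^ k) ^ 3 + 24 * ε * ε / ((L : ℝ) ^ k) ^ 4
          ≤ (16 * c₀ * ε * ε) / ((L : ℝ) ^ k) ^ 3 + 24 * ε * ε / ((L : ℝ) ^ k) ^ 3 := by linarith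
        _ = ((16 * c₀ + 24) * ε) * ε / ((L : ℝ) ^ k) ^ 3 := by ring
        _ ≤ 1 * ε / ((L : ℝ) ^ k) ^ 3 := by
            apply div_le_div_of_nonneg_right _ hM3.le
            exact mul_le_mul_of_nonneg_right hr2 hε.le
        _ = ε / ((L : ℝ) ^ k) ^ 3 := by rw [one_mul]
    have e3 : (CJ + 1) * ε / ((L : ℝ) ^ k) ^ 3 = j + ε / ((L : ℝ) ^ k) ^ 3 := by rw [hjdef]; ring
    rw [e3]
    linarith
  -- (9)₂ with `R = M`
  have hregR : 144 * ((4 : ℕ) : ℝ) * (M : ℕ) * a₀ ≤ 1 := by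
    rw [hMr, ha₀def]
    have : 144 * (4 : ℝ) * (L : ℝ) ^ k * (c₀ * ε / (L : ℝ) ^ k) = 576 * c₀ * ε := by field_simp; ring
    push_cast
    rw [this]; exact hr1
  set G : ℝ := 4 * (4 * c₀ + CJ + 1) * ε / ((L : ℝ) ^ k) ^ 2 with hGdef
  have h92' : ∀ (y : Site 4) (κ τ : Fin 4), ‖A₀ (y + e τ) κ - A₀ y κ‖ ≤ G := by
    intro y κ τ
    have h := h92 hA₀P ha₀s M hM1 hregR y κ τ
    rw [hMr] at h
    refine h.trans ?_
    -- `4(4 a₀/M + M j_ε) ≤ 4(4c₀ + C_J + 1)ε/M²`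
    have t1 : (4 : ℝ) * a₀ / (L : ℝ) ^ k = 4 * c₀ * ε / ((L : ℝ) ^ k) ^ 2 := by rw [ha₀def]; field_simp
    have t2 : (L : ℝ) ^ k * (j + 4 * (εp * ((Real.exp (2 * a₀) - 1) + 2 * εp * (2 + εp)))) ≤ (CJ + 1) * ε / ((L : ℝ) ^ k) ^ 2 := by
      calc _ ≤ (L : ℝ) ^ k * ((CJ + 1) * ε / ((L : ℝ) ^ k) ^ 3) := mul_le_mul_of_nonneg_left hjε hM0.le
        _ = (CJ + 1) * ε / ((L : ℝ) ^ k) ^ 2 := by field_simp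
    have t3 : ((4 : ℕ) : ℝ) * a₀ / (L : ℝ) ^ k + (L : ℝ) ^ k * (j + (4 : ℕ) * (εp * ((Real.exp (2 * a₀) - 1) + 2 * εp * (2 + εp))))
        ≤ (4 * c₀ + CJ + 1) * ε / ((L : ℝ) ^ k) ^ 2 := by
      push_cast
      rw [t1]
      have : 4 * c₀ * ε / ((L : ℝ) ^ k) ^ 2 + (CJ + 1) * ε / ((L : ℝ) ^ k) ^ 2 = (4 * c₀ + CJ + 1) * ε / ((L : ℝ) ^ k) ^ 2 := by ring
      linarith
    calc (4 : ℝ) * (((4 : ℕ) : ℝ) * a₀ / (L : ℝ) ^ k + (L : ℝ) ^ k * (j + (4 : ℕ) * (εp * ((Real.exp (2 * a₀) - 1) + 2 * εp * (2 + εp)))))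
        ≤ 4 * ((4 * c₀ + CJ + 1) * ε / ((L : ℝ) ^ k) ^ 2) := mul_le_mul_of_nonneg_left t3 (by norm_num)
      _ = G := by rw [hGdef]; ring
  -- (10)
  set Λ : ℝ := (CJ + 2) * ε / ((L : ℝ) ^ k) ^ 3 with hΛdef
  have h10' : ∀ (y : Site 4) (ν : Fin 4), ‖∑ i, ((A₀ (y + e i) ν - A₀ y ν) - (A₀ y ν - A₀ (y - e i) ν))‖ ≤ Λ := by
    intro y ν
    refine (h10 G h92' y ν).trans ?_
    -- `j_ε + (16(e^{4a₀}−1) + 8(e^{a₀}−1))G ≤ (C_J+1)ε/M³ + 144 a₀ G ≤ (C_J + 2)ε/M³`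
    have hG0 : 0 ≤ G := by positivity
    have t1 : 4 * ((4 : ℕ) : ℝ) * (Real.exp (4 * a₀) - 1) * G + 2 * ((4 : ℕ) : ℝ) * (Real.exp a₀ - 1) * G ≤ 144 * a₀ * G := by
      push_cast
      nlinarith [mul_nonneg ha₀0 hG0]
    have t2 : 144 * a₀ * G ≤ ε / ((L : ℝ) ^ k) ^ 3 := by
      rw [ha₀def, hGdef]
      have hM3 : (0 : ℝ) < ((L : ℝ) ^ k) ^ 3 := by positivity
      have e1 : 144 * (c₀ * ε / (L : ℝ) ^ k) * (4 * (4 * c₀ + CJ + 1) * ε / ((L : ℝ) ^ k) ^ 2)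
          = (576 * c₀ * (4 * c₀ + CJ + 1) * ε) * ε / ((L : ℝ) ^ k) ^ 3 := by field_simp; ring
      rw [e1]
      calc _ ≤ 1 * ε / ((L : ℝ) ^ k) ^ 3 := div_le_div_of_nonneg_right (mul_le_mul_of_nonneg_right hr3 hε.le) hM3.le
        _ = _ := by rw [one_mul]
    have hjε' : (j + ((4 : ℕ) : ℝ) * (εp * ((Real.exp (2 * a₀) - 1) + 2 * εp * (2 + εp)))) ≤ (CJ + 1) * ε / ((L : ℝ) ^ k) ^ 3 := by
      push_cast; exact hjε
    have e3 : Λ = (CJ + 1) * ε / ((L : ℝ) ^ k) ^ 3 + ε / ((L : ℝ) ^ k) ^ 3 := by rw [hΛdef]; ring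
    calc j + ((4 : ℕ) : ℝ) * (εp * ((Real.exp (2 * a₀) - 1) + 2 * εp * (2 + εp))) + 4 * ((4 : ℕ) : ℝ) * (Real.exp (4 * a₀) - 1) * G
          + 2 * ((4 : ℕ) : ℝ) * (Real.exp a₀ - 1) * G
        = (j + ((4 : ℕ) : ℝ) * (εp * ((Real.exp (2 * a₀) - 1) + 2 * εp * (2 + εp))))
          + (4 * ((4 : ℕ) : ℝ) * (Real.exp (4 * a₀) - 1) * G + 2 * ((4 : ℕ) : ℝ) * (Real.exp a₀ - 1) * G) := by ring
      _ ≤ (CJ + 1) * ε / ((L : ℝ) ^ k) ^ 3 + 144 * a₀ * G := add_le_add hjε' t1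
      _ ≤ (CJ + 1) * ε / ((L : ℝ) ^ k) ^ 3 + ε / ((L : ℝ) ^ k) ^ 3 := by linarith
      _ = Λ := e3.symm
  refine ⟨h92', h10', fun β hβ0 hβ1 x z z' hz hz' μ κ => ?_⟩
  -- (9)₃ at `m = M`
  have h := h93 Λ h10' M hM1 x β hβ0 hβ1 z z' hz hz' μ κ
  rw [hMr] at h
  refine h.trans ?_
  have hsc := rpow_scaling (m := M) hM1 hβ0
  rw [hMr] at hsc
  have hε' : 0 < 1 - β := by linarith
  have hb : (0 : ℝ) ≤ 1 + (1 - β)⁻¹ := by positivity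
  have hh : (0 : ℝ) ≤ (supNorm (z - z') : ℝ) ^ β := Real.rpow_nonneg (by positivity) _
  have e1 : Λ + a₀ / ((L : ℝ) ^ k) ^ 2 = (CJ + 2 + c₀) * ε / ((L : ℝ) ^ k) ^ 3 := by
    rw [hΛdef, ha₀def]; field_simp
  rw [e1]
  have hK : 0 ≤ C * (1 + (1 - β)⁻¹) * ((CJ + 2 + c₀) * ε) := by positivity
  calc C * (1 + (1 - β)⁻¹) * ((CJ + 2 + c₀) * ε / ((L : ℝ) ^ k) ^ 3) * (3 * (L : ℝ) ^ k) ^ (1 - β) * (supNorm (z - z') : ℝ) ^ β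
      = C * (1 + (1 - β)⁻¹) * ((CJ + 2 + c₀) * ε) * ((3 * (L : ℝ) ^ k) ^ (1 - β) / ((L : ℝ) ^ k) ^ 3) * (supNorm (z - z') : ℝ) ^ β := by
        ring
    _ ≤ C * (1 + (1 - β)⁻¹) * ((CJ + 2 + c₀) * ε) * (3 / ((L : ℝ) ^ k) ^ (2 + β)) * (supNorm (z - z') : ℝ) ^ β := by
        apply mul_le_mul_of_nonneg_right _ hh
        exact mul_le_mul_of_nonneg_left hsc hK
    _ = 3 * C * (1 + (1 - β)⁻¹) * (CJ + 2 + c₀) * ε * (supNorm (z - z') : ℝ) ^ β / ((L : ℝ) ^ k) ^ (2 + β) := by ring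

end

end Summit.QuantumFields.BalabanUV.T4Continuum.NE7AllMinimisersLandauReg910
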